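import Mathlib
import HarnessLib
import Literature.NumberTheory.LFunctions.ZetaScrew
import Literature.NumberTheory.LFunctions.ZetaScrewThm41Proofs
import Summits.RiemannHypothesis.RiemannHypothesis.Theorems.IntegerScrewPivotUpperBound

/-!
# Route `IntegerScrew` — the TWO-NODE predictor bound for the pivot (PIVOT-LAW §2a(iv); RH-FREE
# given `S_{M−1} ≻ 0`)

`d_M` is the squared distance of the newest node `x_{log M}` of Kreĭn's screw line from the span of
the earlier nodes (`IntegerScrewPivotUpperBound.screwPivot_add_two_le_form`: `d_M ≤ Q(y,1)` for
every coefficient vector `y`).  The one-node predictor `x_{log(M−1)}` gives `d_M ≤ 2Ψ(h_M)`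
(`screwPivot_add_three_le_increment`).  Here the two-node predictors
`x_{log(M−1)} + t·(x_{log(M−1)} − x_{log(M−2)})`, `t ∈ ℝ`, give, with `h_M = log(M/(M−1))`,
`h_{M−1} = log((M−1)/(M−2))` and the adjacent-increment covariance
`Cov = Ψ(h_M + h_{M−1}) − Ψ(h_M) − Ψ(h_{M−1})`:

* `screwPivot_add_four_le_twoNode` : `d_M ≤ 2Ψ(h_M) + t²·2Ψ(h_{M−1}) − 2t·Cov` for every `t`
  (`M = n + 4`, hypothesis `S_{M−1} ≻ 0`), i.e. `d_M ≤ ‖I_M − t I_{M−1}‖²`;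

optimising in `t` gives `d_M ≤ 2Ψ(h_M) − Cov²/(2Ψ(h_{M−1}))`, the DERIVED «two-node gain» of
PIVOT-LAW §2a(iv) (`≈ (log 2)²/(M(log M − c₀))` by `IntegerScrewIncrementCovariance` and
`IntegerScrewIncrementSharp`).  Nothing here bears on the truth of RH. [Suzuki2023, (1.1), (1.4)]
-/

noncomputable section

-- D-0017: `Summit.<S>.<S>.…` is the designed namespace of a single-problem summit.
set_option linter.dupNamespace false

namespace Summit.RiemannHypothesis.RiemannHypothesis.Theorems.IntegerScrew

open Literature.NumberTheory.LFunctions Literature.NumberTheory.LFunctions.Suzuki2023Thm41 Matrix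

/-- **Two-node predictor bound.** With `S_{n+3} = screwMatrix (n+2) ≻ 0`, for every `t : ℝ`:
`d_{n+4} ≤ 2Ψ(log((n+4)/(n+3))) + t²·2Ψ(log((n+3)/(n+2)))
 − 2t·(Ψ(log((n+4)/(n+2))) − Ψ(log((n+4)/(n+3))) − Ψ(log((n+3)/(n+2))))`
— the squared length of `I_{n+4} − t·I_{n+3}` on the screw line. [folklore] -/
theorem screwPivot_add_four_le_twoNode (n : ℕ) (hn : (screwMatrix (n + 2)).PosDef) (t : ℝ) :
    screwPivot (n + 4) ≤
      2 * zetaScrew (Real.log (((n + 4 : ℕ) : ℝ) / ((n + 3 : ℕ) : ℝ)))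
      + t ^ 2 * (2 * zetaScrew (Real.log (((n + 3 : ℕ) : ℝ) / ((n + 2 : ℕ) : ℝ))))
      - 2 * t * (zetaScrew (Real.log (((n + 4 : ℕ) : ℝ) / ((n + 2 : ℕ) : ℝ)))
          - zetaScrew (Real.log (((n + 4 : ℕ) : ℝ) / ((n + 3 : ℕ) : ℝ)))
          - zetaScrew (Real.log (((n + 3 : ℕ) : ℝ) / ((n + 2 : ℕ) : ℝ)))) := by
  -- indices: l = last ↔ node log(n+3), p ↔ node log(n+2)
  set l : Fin (n + 2) := ⟨n + 1, by omega⟩ with hl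
  set p : Fin (n + 2) := ⟨n, by omega⟩ with hp
  have hlp : l ≠ p := by
    intro h'; have := congrArg Fin.val h'; simp [hl, hp] at this
  have hpl : p ≠ l := fun h' => hlp h'.symm
  have hlv : ((l : ℕ) + 2 : ℕ) = n + 3 := by simp [hl]
  have hpv : ((p : ℕ) + 2 : ℕ) = n + 2 := by simp [hp]
  set a : ℝ := -(1 + t) with ha
  have h := screwPivot_add_two_le_form (n + 2) hn (Pi.single l a + Pi.single p t)
  -- abbreviations for the Ψ-values at the three nodes
  set A : ℝ := zetaScrew (Real.log ((n + 4 : ℕ) : ℝ)) with hA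
  set B : ℝ := zetaScrew (Real.log ((n + 3 : ℕ) : ℝ)) with hB
  set C : ℝ := zetaScrew (Real.log ((n + 2 : ℕ) : ℝ)) with hC
  -- the increments' Ψ-values
  have hP : zetaScrew (Real.log ((n + 3 : ℕ) : ℝ) - Real.log ((n + 4 : ℕ) : ℝ)) =
      zetaScrew (Real.log (((n + 4 : ℕ) : ℝ) / ((n + 3 : ℕ) : ℝ))) := by
    rw [← zetaScrew_neg, neg_sub, ← Real.log_div (by positivity) (by positivity)]
  have hU : zetaScrew (Real.log ((n + 2 : ℕ) : ℝ) - Real.log ((n + 4 : ℕ) : ℝ)) =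
      zetaScrew (Real.log (((n + 4 : ℕ) : ℝ) / ((n + 2 : ℕ) : ℝ))) := by
    rw [← zetaScrew_neg, neg_sub, ← Real.log_div (by positivity) (by positivity)]
  have hR : zetaScrew (Real.log ((n + 3 : ℕ) : ℝ) - Real.log ((n + 2 : ℕ) : ℝ)) =
      zetaScrew (Real.log (((n + 3 : ℕ) : ℝ) / ((n + 2 : ℕ) : ℝ))) := by
    rw [← Real.log_div (by positivity) (by positivity)]
  -- matrix / border entries
  have hSll : screwMatrix (n + 2) l l = 2 * B := by rw [screwMatrix_diag, hlv]
  have hSpp : screwMatrix (n + 2) p p = 2 * C := by rw [screwMatrix_diag, hpv]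
  have hSlp : screwMatrix (n + 2) l p =
      B + C - zetaScrew (Real.log (((n + 3 : ℕ) : ℝ) / ((n + 2 : ℕ) : ℝ))) := by
    rw [screwMatrix_apply, hlv, hpv, zetaScrewKernel_def, hR]
  have hR2 : zetaScrew (Real.log ((n + 2 : ℕ) : ℝ) - Real.log ((n + 3 : ℕ) : ℝ)) =
      zetaScrew (Real.log (((n + 3 : ℕ) : ℝ) / ((n + 2 : ℕ) : ℝ))) := by
    rw [← zetaScrew_neg, neg_sub, hR]
  have hSpl : screwMatrix (n + 2) p l =
      B + C - zetaScrew (Real.log (((n + 3 : ℕ) : ℝ) / ((n + 2 : ℕ) : ℝ))) := by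
    rw [screwMatrix_apply, hlv, hpv, zetaScrewKernel_def, hR2]
    ring
  have hbl : screwBorder (n + 2) l 0 =
      B + A - zetaScrew (Real.log (((n + 4 : ℕ) : ℝ) / ((n + 3 : ℕ) : ℝ))) := by
    simp only [screwBorder, Matrix.of_apply, hlv, zetaScrewKernel_def]
    rw [show ((n + 2 + 2 : ℕ) : ℝ) = ((n + 4 : ℕ) : ℝ) by push_cast; ring, hP]
  have hbp : screwBorder (n + 2) p 0 =
      C + A - zetaScrew (Real.log (((n + 4 : ℕ) : ℝ) / ((n + 2 : ℕ) : ℝ))) := by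
    simp only [screwBorder, Matrix.of_apply, hpv, zetaScrewKernel_def]
    rw [show ((n + 2 + 2 : ℕ) : ℝ) = ((n + 4 : ℕ) : ℝ) by push_cast; ring, hU]
  -- evaluate the quadratic form at y = a·e_l + t·e_p
  have hquad : (Pi.single l a + Pi.single p t) ⬝ᵥ screwMatrix (n + 2) *ᵥ (Pi.single l a + Pi.single p t)
      = a * a * screwMatrix (n + 2) l l + a * t * screwMatrix (n + 2) l p
        + t * a * screwMatrix (n + 2) p l + t * t * screwMatrix (n + 2) p p := by
    rw [mulVec_add, dotProduct_add, add_dotProduct, add_dotProduct]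
    simp only [single_dotProduct, mulVec, dotProduct_single]
    ring
  have hlin : (fun i => screwBorder (n + 2) i 0) ⬝ᵥ (Pi.single l a + Pi.single p t)
      = screwBorder (n + 2) l 0 * a + screwBorder (n + 2) p 0 * t := by
    rw [dotProduct_add, dotProduct_single, dotProduct_single]
  rw [hquad, hlin, hSll, hSpp, hSlp, hSpl, hbl, hbp] at h
  have h44 : n + 2 + 2 = n + 4 := by norm_num
  rw [h44] at h
  rw [ha] at h
  nlinarith [h, sq_nonneg t]

/-- **Optimised two-node bound:** with `S_{n+3} ≻ 0`,
`d_{n+4} ≤ 2Ψ(h) − Cov²/(2Ψ(h′))`, `h = log((n+4)/(n+3))`, `h′ = log((n+3)/(n+2))`,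
`Cov = Ψ(h + h′) − Ψ(h) − Ψ(h′)` (take `t = Cov/(2Ψ(h′))`; `Ψ(h′) > 0` unconditionally since
`0 < h′ ≤ log 2`, Suzuki2023 Thm 4.1 as `zetaScrew_pos_of_le_log_two`).  This is PIVOT-LAW §2a(iv)'s
«two-node predictor gain» inequality; by `IntegerScrewIncrementCovariance` and
`IntegerScrewIncrementSharp` the gain is `≈ (log 2)²/(M(log M − c₀))`. [folklore] -/
theorem screwPivot_add_four_le_twoNode_opt (n : ℕ) (hn : (screwMatrix (n + 2)).PosDef) :
    screwPivot (n + 4) ≤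
      2 * zetaScrew (Real.log (((n + 4 : ℕ) : ℝ) / ((n + 3 : ℕ) : ℝ)))
      - (zetaScrew (Real.log (((n + 4 : ℕ) : ℝ) / ((n + 2 : ℕ) : ℝ)))
          - zetaScrew (Real.log (((n + 4 : ℕ) : ℝ) / ((n + 3 : ℕ) : ℝ)))
          - zetaScrew (Real.log (((n + 3 : ℕ) : ℝ) / ((n + 2 : ℕ) : ℝ)))) ^ 2
        / (2 * zetaScrew (Real.log (((n + 3 : ℕ) : ℝ) / ((n + 2 : ℕ) : ℝ)))) := by
  set R : ℝ := zetaScrew (Real.log (((n + 3 : ℕ) : ℝ) / ((n + 2 : ℕ) : ℝ))) with hRdef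
  set Cv : ℝ := zetaScrew (Real.log (((n + 4 : ℕ) : ℝ) / ((n + 2 : ℕ) : ℝ)))
      - zetaScrew (Real.log (((n + 4 : ℕ) : ℝ) / ((n + 3 : ℕ) : ℝ))) - R with hCv
  have hn2 : (0 : ℝ) < ((n + 2 : ℕ) : ℝ) := by positivity
  have hR0 : 0 < R := by
    apply zetaScrew_pos_of_le_log_two
    · apply Real.log_pos
      rw [one_lt_div hn2]; push_cast; linarith
    · apply Real.log_le_log (by positivity)
      rw [div_le_iff₀ hn2]; push_cast; linarith
  have h := screwPivot_add_four_le_twoNode n hn (Cv / (2 * R))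
  have hkey : (Cv / (2 * R)) ^ 2 * (2 * R) - 2 * (Cv / (2 * R)) * Cv = -(Cv ^ 2 / (2 * R)) := by
    field_simp
    ring
  linarith [h, hkey]

end Summit.RiemannHypothesis.RiemannHypothesis.Theorems.IntegerScrew
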